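import Mathlib
import Summits.Parity.GeneralizedHardyLittlewood.Theses.LiouvilleShiftedTables

/-!
# Sketch — crux-ideate stmt-Parity-14270 (TableChowla), ideator 1, round 1

First-lemma signatures for the two idea cards (Props over existing declarations; nothing is
proved here).  `λ` = `ArithmeticFunction.liouville`, arguments `ab+c : ℤ` sent to `ℕ` by
`Int.toNat` exactly as in the route file.
-/

open scoped BigOperators Classical
open Finset

namespace Summit.Parity.GeneralizedHardyLittlewood.Cruxes.TableChowla.Ideator1

/-- real Liouville at an integer (junk `λ(0)=0` at nonpositive arguments, as in the route). -/
noncomputable def lam (z : ℤ) : ℝ := (ArithmeticFunction.liouville (Int.toNat z) : ℝ)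

/-! ## Card `open-lambda-determinant-tables` -/

/-- number of `b ≤ B` with `v ∣ ab + c` (the exact local density numerator). -/
noncomputable def classCount (a v : ℕ) (c : ℤ) (B : ℕ) : ℕ :=
  ((Icc 1 B).filter (fun b : ℕ => (v : ℤ) ∣ (a : ℤ) * b + c)).card

/-- FIRST LEMMA (Type-I shifted tables are power-small; prime-cofactor form, which is TRUE as
stated).  For a kernel `K(n) = Σ_{p ∣ n, V < p ≤ 2V, p prime} α_p` with `|α_p| ≤ 1` (one smooth
cofactor `w = n/p` summed trivially), the CENTRED bilinear form of the shifted table,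
`Σ_a Σ_p γ_a α_p ( Σ_{b ≤ B, p ∣ ab+c} δ_b − (N(a,p,B)/B) Σ_{b ≤ B} δ_b )`,
is `≤ K ‖γ‖ ‖δ‖ (V + √B) (1 + √(A/V))` once `V > |c|` and `A ≤ B` — additive characters mod `p`,
the additive large sieve over the (reduced!) Farey points `t/p`, and the collision count
`c ā ≡ c ā' (mod p) ⇔ a ≡ a' (mod p)`; no Kloosterman-fraction cancellation is used.  Nontrivial
against the target `√(AB)(log x)^{-C}` exactly when `(log x)^{2C} ≤ V ≤ x^{1/2-ε}`.  (Composite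
cofactors `v`: centre instead by the local model at every `q' ∣ v`, `q' ≤ (log x)^{C''}`; the
structured remainder is absorbed by SW-goodness of `α` — see the card.) -/
def TypeOneTableCentered : Prop :=
  ∀ c : ℤ, c ≠ 0 → ∃ K : ℝ, 0 < K ∧ ∀ A B V : ℝ, 1 ≤ A → A ≤ B → (|(c : ℝ)|) < V →
    ∀ α : ℕ → ℂ, (∀ v, ‖α v‖ ≤ 1) → ∀ γ δ : ℕ → ℂ,
      ‖∑ a ∈ Ioc ⌊A⌋₊ ⌊2 * A⌋₊, ∑ v ∈ (Ioc ⌊V⌋₊ ⌊2 * V⌋₊).filter (fun v : ℕ => v.Prime),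
          γ a * α v *
          ((∑ b ∈ (Icc 1 ⌊B⌋₊).filter (fun b : ℕ => (v : ℤ) ∣ (a : ℤ) * b + c), δ b) -
            ((classCount a v c ⌊B⌋₊ : ℂ) / (⌊B⌋₊ : ℂ)) * ∑ b ∈ Icc 1 ⌊B⌋₊, δ b)‖ ≤
        K * Real.sqrt (∑ a ∈ Ioc ⌊A⌋₊ ⌊2 * A⌋₊, ‖γ a‖ ^ 2) *
          Real.sqrt (∑ b ∈ Icc 1 ⌊B⌋₊, ‖δ b‖ ^ 2) *
          (V + Real.sqrt B) * (1 + Real.sqrt (A / V))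

/-- Siegel–Walfisz-type hypothesis on a coefficient sequence `α` living on `(V, 2V]`:
`(log x)^{-C'}` cancellation in every progression of modulus `q ≤ (log x)^{C'}` and every
initial segment.  (Möbius-type Heath-Brown pieces satisfy it through their `μ(m₁)` factor.) -/
def SWGood (x V C' : ℝ) (α : ℕ → ℂ) : Prop :=
  ∀ q : ℕ, 1 ≤ q → (q : ℝ) ≤ Real.log x ^ C' → ∀ r : ℕ, ∀ y : ℝ, V ≤ y → y ≤ 2 * V →
    ‖∑ v ∈ (Ioc ⌊V⌋₊ ⌊y⌋₊).filter (fun v : ℕ => v ≡ r [MOD q]), α v‖ ≤ V / Real.log x ^ C'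

/-- TRANSFER TARGET `C⁺` (balanced Type-II(λ) tables): for `1`-bounded `α` on `(V,2V]`
(SW-good) and `β` on `(W,2W]`, `V, W ∈ [x^{1/2-ε}, x^{1/2+ε}]`, the shifted table of
`F = α ⋆ β` has fourth moment `≤ x²(log x)^{-C}` uniformly in the crux window.  The honest
content of the core: the 4-linear determinant form `vw − ab = c` with two SW-good and two
arbitrary coefficient vectors. -/
def BalancedCoreTable : Prop :=
  ∀ c : ℤ, c ≠ 0 → ∀ δ : ℝ, 0 < δ → δ ≤ 1 / 12 → ∀ ε : ℝ, 0 < ε → ε ≤ 1 / 100 →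
    ∀ C : ℝ, 0 < C → ∃ C' x₀ : ℝ, ∀ x : ℝ, x₀ ≤ x →
    ∀ A : ℝ, x ^ δ ≤ A → A ≤ x ^ (1 / 3 + δ) →
    ∀ V W : ℝ, x ^ (1 / 2 - ε) ≤ V → V ≤ x ^ (1 / 2 + ε) → x ^ (1 / 2 - ε) ≤ W →
      W ≤ x ^ (1 / 2 + ε) →
    ∀ α β : ℕ → ℂ, (∀ v, ‖α v‖ ≤ 1) → (∀ w, ‖β w‖ ≤ 1) →
      (∀ v, α v ≠ 0 → V < v ∧ (v : ℝ) ≤ 2 * V) → (∀ w, β w ≠ 0 → W < w ∧ (w : ℝ) ≤ 2 * W) →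
      SWGood x V C' α →
      (∑ a ∈ Ioc ⌊A⌋₊ ⌊2 * A⌋₊, ∑ a' ∈ Ioc ⌊A⌋₊ ⌊2 * A⌋₊,
        ‖∑ b ∈ Icc 1 ⌊x / A⌋₊,
          (∑ v ∈ (Ioc ⌊V⌋₊ ⌊2 * V⌋₊).filter (fun v : ℕ => (v : ℤ) ∣ (a : ℤ) * b + c),
              α v * β (Int.toNat (((a : ℤ) * b + c) / v))) *
          (starRingEnd ℂ) (∑ v ∈ (Ioc ⌊V⌋₊ ⌊2 * V⌋₊).filter
              (fun v : ℕ => (v : ℤ) ∣ (a' : ℤ) * b + c),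
              α v * β (Int.toNat (((a' : ℤ) * b + c) / v)))‖ ^ 2) ≤ x ^ 2 / Real.log x ^ C

/-! ## Card `pivot-pair-level-half` -/

/-- Alignment identity used throughout (complete multiplicativity of `λ`):
`λ(a') λ(ab+c) = λ(aa'b + a'c)` for `a, a', b ≥ 1` and `ab + c ≥ 1`. -/
def Alignment : Prop :=
  ∀ a a' b : ℕ, ∀ c : ℤ, 1 ≤ a → 1 ≤ a' → 1 ≤ b → 1 ≤ (a : ℤ) * b + c →
    lam a' * lam ((a : ℤ) * b + c) = lam ((a : ℤ) * a' * b + a' * c)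

/-- Pairs with `|a − a'| ≤ H` are negligible in the fourth moment (trivial bound `|S| ≤ B`):
their contribution is `≤ (2H+1)(A+1)(x/A)²`; with `H = (log x)^{2C}` this is
`≪ x²(log x)^{2C}/A ≤ x²(log x)^{-C}` since `A ≥ x^δ`.  (Provable now.) -/
def NearDiagonalNegligible : Prop :=
  ∀ c : ℤ, ∀ A B H : ℝ, 1 ≤ A → 1 ≤ B → 0 ≤ H →
    (∑ a ∈ Ioc ⌊A⌋₊ ⌊2 * A⌋₊, ∑ a' ∈ (Ioc ⌊A⌋₊ ⌊2 * A⌋₊).filter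
        (fun a' : ℕ => |(a' : ℝ) - a| ≤ H),
      (∑ b ∈ Icc 1 ⌊B⌋₊, lam ((a : ℤ) * b + c) * lam ((a' : ℤ) * b + c)) ^ 2) ≤
      (2 * H + 1) * (A + 1) * B ^ 2

/-- FIRST LEMMA of the line: shift-averaged, character-twisted two-point Chowla with a LOG-POWER
saving for shift ranges `H ≥ X^{θ₀+ε}`:
`Σ_{0<h≤H} |Σ_{n ≤ X} λ(n)λ(n+h)χ(n)|² ≤ H X² (log X)^{-C}` for every `χ (mod q)`, `q ≤ (log X)^C`.
Provable-now technology at `θ₀ = 1/3` (Mikawa-type circle method + zero density, written for `Λ`-pairs)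
and plausibly at `θ₀ = 8/33` (MRT 2019 long shift ranges); conjectural for every `θ₀ > 0`.  This is
the "model" (small-conductor) part of the crux after BDH; needed with `H = 2|c|A`. -/
def AvgTwistedChowlaLog (θ₀ : ℝ) : Prop :=
  ∀ ε : ℝ, 0 < ε → ∀ C : ℝ, 0 < C → ∃ X₀ : ℝ, ∀ X : ℝ, X₀ ≤ X → ∀ H : ℝ,
    X ^ (θ₀ + ε) ≤ H → H ≤ X →
    ∀ q : ℕ, 1 ≤ q → (q : ℝ) ≤ Real.log X ^ C → ∀ χ : DirichletCharacter ℂ q,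
      (∑ h ∈ Icc 1 ⌊H⌋₊,
        ‖∑ n ∈ Icc 1 ⌊X⌋₊, (lam n : ℂ) * (lam ((n : ℤ) + h) : ℂ) * χ (n : ZMod q)‖ ^ 2) ≤
        H * X ^ 2 / Real.log X ^ C

/-- The crux-level statement this line isolates (the irreducible content, organised by shift):
level-of-distribution `½`-type control of Chowla's pair sequences `g_h(u) = λ(u)λ(u+h)`,
`h = c(a−a')`, on ONE residue `a'c (mod aa')` per multiplication-table modulus, in `ℓ²` over the
family, after removing nothing (λ has no small-conductor model).  Stated as the aligned form of
the crux's fourth moment with the near-diagonal pairs removed. -/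
def PairFamilyLevel : Prop :=
  ∀ c : ℤ, c ≠ 0 → ∀ δ : ℝ, 0 < δ → δ ≤ 1 / 12 → ∀ C : ℝ, 0 < C → ∃ x₀ : ℝ, ∀ x : ℝ, x₀ ≤ x →
    ∀ A : ℝ, x ^ δ ≤ A → A ≤ x ^ (1 / 3 + δ) →
    (∑ a ∈ Ioc ⌊A⌋₊ ⌊2 * A⌋₊, ∑ a' ∈ (Ioc ⌊A⌋₊ ⌊2 * A⌋₊).filter
        (fun a' : ℕ => Real.log x ^ (2 * C) < |(a' : ℝ) - a|),
      (∑ b ∈ Icc 1 ⌊x / A⌋₊,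
        lam ((a : ℤ) * a' * b + a' * c) * lam ((a : ℤ) * a' * b + a * c)) ^ 2) ≤
      x ^ 2 / Real.log x ^ C

/-- The composition this card proposes (to be proved in crux-plan):
`Alignment ∧ NearDiagonalNegligible ∧ PairFamilyLevel → TableChowla` (the route decl, by name). -/
def PivotAssembly : Prop :=
  Alignment → NearDiagonalNegligible → PairFamilyLevel →
    Summit.Parity.GeneralizedHardyLittlewood.Theses.LiouvilleShiftedTables.TableChowla

/-! ## Shared calibration: the transposed first-moment shadow (necessary condition) -/

/-- `N₁`-bound: mean square over moduli `b ≤ x/A` of `λ` on the `A`-term stretch of the fixed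
class `c (mod b)` — a fixed-residue Barban–Davenport–Halberstam statement for `λ` at level
`1 − log A/log x ∈ [2/3−δ, 1−δ]`.  `TableChowla` implies it (Cauchy–Schwarz:
`N₁ = Σ_{a,a'} S(a,a') ≤ A·T^{1/2}`); at `A = x^δ` it is Elliott–Halberstam-flavoured. -/
def ColumnFirstMoment : Prop :=
  ∀ c : ℤ, c ≠ 0 → ∀ δ : ℝ, 0 < δ → δ ≤ 1 / 12 → ∀ C : ℝ, 0 < C → ∃ x₀ : ℝ, ∀ x : ℝ, x₀ ≤ x →
    ∀ A : ℝ, x ^ δ ≤ A → A ≤ x ^ (1 / 3 + δ) →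
    (∑ b ∈ Icc 1 ⌊x / A⌋₊, (∑ a ∈ Ioc ⌊A⌋₊ ⌊2 * A⌋₊, lam ((a : ℤ) * b + c)) ^ 2) ≤
      A * x / Real.log x ^ C

/-- necessary-condition lemma (provable now): the crux implies the shadow. -/
def ShadowOfTable : Prop :=
  Summit.Parity.GeneralizedHardyLittlewood.Theses.LiouvilleShiftedTables.TableChowla →
    ColumnFirstMoment

end Summit.Parity.GeneralizedHardyLittlewood.Cruxes.TableChowla.Ideator1
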